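import Literature.AnabelianGeometry.EtaleTheta.SettingModelChiTheta
import Literature.AnabelianGeometry.EtaleTheta.SettingModelChiKummerData
import Literature.AnabelianGeometry.EtaleTheta.SettingModelChiDoubleUnderline
import Literature.AnabelianGeometry.EtaleTheta.DoubleUnderline
import HarnessLib

/-!
# The χ-twisted root model of [EtTh] §1: `Sec2Hyps` and the `E`-free clauses of the choice `X̲̲` at the RECORD
# `ThetaSetting.modelχ` (R78 cluster, hand #2′ — record-level assembly)

Mochizuki, *The étale theta function …*, Publ. RIMS **45** (2009) [EtTh], Def. 2.5 (i) p. 39 ("`K = K̈`"; "`Π_X ↠ Q`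
factors through `Π^tp_X ↠ Z`"), Prop. 2.2 (ii)/(iii) p. 37, Def. 2.7 p. 41, Prop. 2.12 (i) p. 45
[cite: MochizukiEtTh2009, Def 2.5 (i) p.39].  abc-iut cell, layer L2, prover abc-iut-L2-d1 (gen 5), R78 cluster hand
#2′ over abc-iut-L2-t1's record `ThetaSetting.modelχ p` (F5b, `SettingModelChiTheta`), this seat's constituent-level
files `SettingModelChiSec2Hyps` (`fieldKN_bot_qModel_two`, `ker_thetaToEll_comp_toTheta_inf_ker_toZ_le_YNχ`) and
`SettingModelChiDoubleUnderline` (`Huuχ` and its five clauses), abc-iut-w5-d171's `SettingModelChiKummerData` (the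
instance keys `deltaTheta_modelχ_normal` / `deltaTheta_modelχ_isMulCommutative` at the concrete record), and abc-iut-L2-t8's
`ThetaCyclotomes` / `DoubleUnderline` (`Sec2Hyps`, `GtpYdd_eq_GtpYN_two`, `EtaleThetaData.DoubleUnderline`).

* `ThetaSetting.modelχ_sec2Hyps` — **the χ-model satisfies `Sec2Hyps`** (`K̈ = K = ℚ_p`;
  `Ker(Π^tp_X ↠ (Π^tp_X)^ell) ∩ Π^tp_Y ≤ Π^tp_{Y_N}`); `modelχ_isEtThOrigin_and_hYcl_and_sec2Hyps`;
* `GtpYdd_modelχ` (`Π^tp_Ÿ = Π^tp_{Y₂}`), `GK_modelχ` (`G_K = G_{ℚ_p}`);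
* the `E`-free `DoubleUnderline` clauses at the record: `map_aug_GtpYdd_inf_Huuχ`, `map_toZ_Huuχ_modelχ`,
  `relIndex_Huuχ_GtpY_modelχ`, **`map_toTheta_Huuχ_modelχ`** (`θ(Π^tp_X̲̲) ∩ Δ_Θ = l·Δ_Θ`);
* `EtaleThetaData.doubleUnderlineχOfEtaRes` — for EVERY étale-theta datum `E` over `modelχ`, the choice `X̲̲ := Huuχ p l`
  is an `E.DoubleUnderline l` as soon as the one `E`-dependent clause holds (`η̈^Θ|_{Π^tp_Ÿ ∩ Π^tp_X̲̲}` represented by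
  an `l·Δ_Θ`-valued cocycle) — the reduction of abc-iut-L2-t8's INPUT N3 at the χ-model to that single clause, to be
  instantiated by abc-iut-L2-t6's F7 datum.
SEMI-SYNTHETIC MODEL, consistency evidence only; nothing of [EtTh] asserted; no side taken on [IUTchIII] Cor. 3.12.
-/

noncomputable section

namespace Literature.AnabelianGeometry.EtaleTheta.SettingModel

open Literature.AnabelianGeometry.SemiGraphs

variable (p : ℕ) [Fact p.Prime]

/-! ### `Sec2Hyps` at the record -/

/-- **The χ-model satisfies the §2 hypotheses `Sec2Hyps`** (`K = K̈`; `Ker(Π^tp_X ↠ (Π^tp_X)^ell) ∩ Π^tp_Y ≤ Π^tp_{Y_N}`).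
[cite: MochizukiEtTh2009, Def 2.5 p.39] -/
theorem _root_.Literature.AnabelianGeometry.EtaleTheta.ThetaSetting.modelχ_sec2Hyps :
    (ThetaSetting.modelχ p).Sec2Hyps where
  Kdd_eq := by
    change fieldKN ⊥ (qModel p) 2 = ⊥
    exact fieldKN_bot_qModel_two p
  ker_toEll_le_GtpYN := ker_thetaToEll_comp_toTheta_inf_ker_toZ_le_YNχ p

/-- **Root + guard + `hYcl` + `Sec2Hyps` hold together at the χ-model** (non-trivial Galois action on `Δ_Θ`).
[cite: MochizukiEtTh2009, Def 2.5 p.39] -/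
theorem _root_.Literature.AnabelianGeometry.EtaleTheta.ThetaSetting.modelχ_isEtThOrigin_and_hYcl_and_sec2Hyps :
    (ThetaSetting.modelχ p).IsEtThOrigin ∧
      ((ThetaSetting.modelχ p).DtpY.map (ThetaSetting.modelχ p).toHat.toMonoidHom).topologicalClosure ≤
        (ThetaSetting.modelχ p).DtpY.map (ThetaSetting.modelχ p).toHat.toMonoidHom ⊔
          (⁅⁅(ThetaSetting.modelχ p).DeltaHat, (ThetaSetting.modelχ p).DeltaHat⁆,
            (ThetaSetting.modelχ p).DeltaHat⁆).topologicalClosure ∧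
      (ThetaSetting.modelχ p).Sec2Hyps :=
  ⟨ThetaSetting.modelχ_isEtThOrigin p, hYcl_modelχ p, ThetaSetting.modelχ_sec2Hyps p⟩

/-- `Π^tp_Ÿ = Π^tp_{Y₂}` at the χ-model (`K = K̈`). [cite: MochizukiEtTh2009, §1 p.17] -/
theorem GtpYdd_modelχ : (ThetaSetting.modelχ p).GtpYdd = YNχ p 2 :=
  ThetaSetting.GtpYdd_eq_GtpYN_two (ThetaSetting.modelχ_sec2Hyps p)

/-- `G_K = G_{ℚ_p}` at the χ-model (`K = ℚ_p`). [cite: MochizukiEtTh2009, §1 p.11] -/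
theorem GK_modelχ : (ThetaSetting.modelχ p).GK = ⊤ :=
  IntermediateField.fixingSubgroup_bot

/-! ### The `E`-free clauses of `X̲̲ := Huuχ p l` at the record -/

/-- **`Π^tp_Ÿ ∩ Π^tp_X̲̲ ↠ G_K`** at the χ-model. [cite: MochizukiEtTh2009, Prop 2.2 (iii) p.37] -/
theorem map_aug_GtpYdd_inf_Huuχ (l : ℕ+) :
    ((ThetaSetting.modelχ p).GtpYdd ⊓ Huuχ p l).map (ThetaSetting.modelχ p).aug.toMonoidHom =
      (ThetaSetting.modelχ p).GK := by
  rw [GtpYdd_modelχ, GK_modelχ]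
  exact map_augχ_YNχ_two_inf_Huuχ p l

/-- **`toZ(Π^tp_X̲̲) = l·Z`** at the χ-model. [cite: MochizukiEtTh2009, Def 2.5 (i) p.39] -/
theorem map_toZ_Huuχ_modelχ (l : ℕ+) :
    (Huuχ p l).map (ThetaSetting.modelχ p).toZ = Subgroup.zpowers (Multiplicative.ofAdd ((l : ℕ) : ℤ)) :=
  map_toZ_Huuχ p l

/-- **`[Π^tp_Y : Π^tp_Y ∩ Π^tp_X̲̲] = l`** at the χ-model. [cite: MochizukiEtTh2009, Def 2.7 p.41] -/
theorem relIndex_Huuχ_GtpY_modelχ (l : ℕ+) :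
    (Huuχ p l ⊓ (ThetaSetting.modelχ p).GtpY).relIndex (ThetaSetting.modelχ p).GtpY = l :=
  relIndex_Huuχ_inf_ker_toZ p l

/-- **`θ(Π^tp_X̲̲) ∩ Δ_Θ = l·Δ_Θ`** at the χ-model ("`Ker(Δ^Θ_* ↠ Δ^ell_*) = l·Δ_Θ`").
[cite: MochizukiEtTh2009, Prop 2.12 (i) p.45] -/
theorem map_toTheta_Huuχ_modelχ (l : ℕ+) :
    (Huuχ p l).map (ThetaSetting.modelχ p).toTheta ⊓ (ThetaSetting.modelχ p).DeltaTheta =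
      (ThetaSetting.modelχ p).lDeltaTheta l := by
  ext x
  constructor
  · intro h
    obtain ⟨hx, hxΔ⟩ := Subgroup.mem_inf.mp h
    exact exists_pow_eq_of_mem_map_toTheta_Huuχ p l hx hxΔ
  · rintro ⟨y, hy, rfl⟩
    exact Subgroup.mem_inf.mpr ⟨pow_mem_map_toTheta_Huuχ p l hy, pow_mem hy _⟩

/-! ### The choice `X̲̲` for an étale-theta datum, modulo the one `E`-dependent clause -/

-- The `Normal` / `IsMulCommutative` instances of `(modelχ p).DeltaTheta` at the concrete record (instance-retrieval
-- keys, cf. `thetaKerχ_normal`) are abc-iut-w5-d171's `deltaTheta_modelχ_normal` / `deltaTheta_modelχ_isMulCommutative`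
-- (`SettingModelChiKummerData`, imported): they are what lets the cocycle-level clause below be STATED at `modelχ`.

/-- **The choice `X̲̲ := Huuχ p l` at the χ-model is an `E.DoubleUnderline l`** for every étale-theta datum `E` over
`modelχ` and every odd `l`, GIVEN the single `E`-dependent clause of abc-iut-L2-t8's structure: "upon restriction to
`Ÿ̲̲ → Ÿ` the class `η̈^Θ` determines a class in `H¹(Π^tp_Ÿ̲̲, l·Δ_Θ)`" (Def. 2.7, p. 41) — all other clauses are the
theorems above.  (The clause is supplied by the producer of `E`; for the `Ẑ`-coordinate crossed homomorphism it holds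
by the divisibility behind `exists_pow_eq_of_mem_map_toTheta_Huuχ`.) [cite: MochizukiEtTh2009, Def 2.7 p.41] -/
def _root_.Literature.AnabelianGeometry.EtaleTheta.ThetaSetting.EtaleThetaData.doubleUnderlineχOfEtaRes
    (l : ℕ+) (hl : Odd (l : ℕ)) (E : (ThetaSetting.modelχ p).EtaleThetaData)
    (heta : ∃ (f : ↥((ThetaSetting.modelχ p).GtpYdd ⊓ Huuχ p l) → (ThetaSetting.modelχ p).DeltaTheta)
        (hf : f ∈ contCocycles (ThetaSetting.modelχ p).toTheta (ThetaSetting.modelχ p).DeltaTheta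
          ((ThetaSetting.modelχ p).GtpYdd ⊓ Huuχ p l)),
        (∀ g, (f g : (ThetaSetting.modelχ p).GtpTheta) ∈ (ThetaSetting.modelχ p).lDeltaTheta l) ∧
          ContH1.mk f hf =
            ContH1.res (ThetaSetting.modelχ p).toTheta (ThetaSetting.modelχ p).DeltaTheta inf_le_left E.etaDd) :
    E.DoubleUnderline l where
  l_odd := hl
  Huu := Huuχ p l
  isOpen_Huu := isOpen_Huuχ p l
  map_aug_Ydduu := map_aug_GtpYdd_inf_Huuχ p l
  map_toZ_Huu := map_toZ_Huuχ_modelχ p l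
  relIndex_Huu_GtpY := relIndex_Huuχ_GtpY_modelχ p l
  map_toTheta_Huu := map_toTheta_Huuχ_modelχ p l
  eta_res := heta

/-- The `Π^tp_X̲̲` of that choice is `Huuχ p l` (by construction). [cite: MochizukiEtTh2009, Def 2.7 p.41] -/
theorem _root_.Literature.AnabelianGeometry.EtaleTheta.ThetaSetting.EtaleThetaData.doubleUnderlineχOfEtaRes_Huu
    (l : ℕ+) (hl : Odd (l : ℕ)) (E : (ThetaSetting.modelχ p).EtaleThetaData) (heta) :
    (E.doubleUnderlineχOfEtaRes p l hl heta).Huu = Huuχ p l := rfl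

end Literature.AnabelianGeometry.EtaleTheta.SettingModel

end
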